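import Summits.AtomisticToContinuum.BoseEinsteinCondensation.Theses.BECThomsonPrinciple
import Summits.AtomisticToContinuum.BoseEinsteinCondensation.Theorems.BECThomsonPrinciplePeriodicToDirichletAnchors
import Summits.AtomisticToContinuum.BoseEinsteinCondensation.Theorems.BECThomsonPrinciplePeriodicToDirichletResidual
import Summits.AtomisticToContinuum.BoseEinsteinCondensation.Theses.BECPeriodicReduction

/-!
# Route `BECThomsonPrinciple`, item `Assembly` (stmt-AtomisticToContinuum-14549) — reductions

`Assembly := GaussianDominationCan → _root_.BoseEinsteinCondensation` ("it suffices to show canonical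
`T = 0` Gaussian domination on the torus"). It is the composition of the two transfer cruxes of the
route — `GDTransfer : GaussianDominationCan → PeriodicBEC` (stmt-AtomisticToContinuum-9482, variational
`T = 0` Kennedy–Lieb–Shastry) and `PeriodicToDirichlet : PeriodicBEC → BoseEinsteinCondensation`
(stmt-AtomisticToContinuum-9483) — i.e. the route's deciding theorem `closes` curried
(`assembly_of_transfer`).

Over the tree, `PeriodicToDirichlet` is already reduced to the single registered open stub
`RewardPaysTheWall.Unrewarding` of the crux line `reward-pays-the-wall`
(`RewardPaysTheWall.periodicToDirichlet_of_unrewarding`,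
`Theorems/BECThomsonPrinciplePeriodicToDirichletAnchors.lean`), so the item is closed modulo exactly
two named open statements: `GDTransfer` and `Unrewarding` (`assembly_of_gdTransfer_of_unrewarding`).
Pure logic; the analytic content lives in those two statements. Helpers `--supports`
stmt-AtomisticToContinuum-14549; the closing theorem `assembly_proof : Assembly` is to be appended here
once both land.
-/

namespace Summit.AtomisticToContinuum.BoseEinsteinCondensation.Theorems

open Summit.AtomisticToContinuum.BoseEinsteinCondensation.Theses.BECThomsonPrinciple

/-- `Assembly` from the two transfer cruxes of the route: `GDTransfer` turns canonical Gaussian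
domination into periodic BEC, `PeriodicToDirichlet` turns periodic BEC into the audited Dirichlet
conjunct (the deciding theorem `closes`, curried). [folklore] -/
theorem assembly_of_transfer (hT : GDTransfer) (hP : PeriodicToDirichlet) : Assembly :=
  fun hG => closes hG hT hP

/-- `Assembly` modulo the two open statements left in the tree: the crux `GDTransfer`
(stmt-AtomisticToContinuum-9482) and the registered stub `RewardPaysTheWall.Unrewarding` of crux
`PeriodicToDirichlet` (stmt-AtomisticToContinuum-9483), via the landed anchors
`RewardPaysTheWall.periodicToDirichlet_of_unrewarding`. [folklore] -/
theorem assembly_of_gdTransfer_of_unrewarding (hT : GDTransfer)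
    (hU : RewardPaysTheWall.Unrewarding) : Assembly :=
  assembly_of_transfer hT (RewardPaysTheWall.periodicToDirichlet_of_unrewarding hU)

end Summit.AtomisticToContinuum.BoseEinsteinCondensation.Theorems

/-! ## Further reductions (session 2026-08-16, seat -1)

`Assembly` closed modulo other pairs of named open statements of the tree, so that whichever lands
first closes the item by a one-liner: the per-potential boundary transfer `BoundaryTransferWeak`
(stmt-AtomisticToContinuum-0827, the shared crux of every periodic-first route) in place of
`PeriodicToDirichlet`, and torus BEC `PeriodicBEC` (route `BECPeriodicReduction`, targeted by several
routes) in place of `GaussianDominationCan ∧ GDTransfer`. Pure logic. -/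

namespace Summit.AtomisticToContinuum.BoseEinsteinCondensation.Theorems

open Summit.AtomisticToContinuum.BoseEinsteinCondensation.Theses
open Summit.AtomisticToContinuum.BoseEinsteinCondensation.Theses.BECThomsonPrinciple

/-- `PeriodicToDirichlet` from the per-potential transfer `BoundaryTransferWeak` (stmt-0827): the
antecedent `PeriodicBEC` at `v` is verbatim the hypothesis of `BoundaryTransferWeak v`. [folklore] -/
theorem periodicToDirichlet_of_boundaryTransferWeak (hB : BECPeriodicReduction.BoundaryTransferWeak) :
    PeriodicToDirichlet :=
  fun hP v hv => hB v hv (hP v hv)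

/-- `Assembly` modulo `GDTransfer` (stmt-9482) and `BoundaryTransferWeak` (stmt-0827). [folklore] -/
theorem assembly_of_gdTransfer_of_boundaryTransferWeak (hT : GDTransfer)
    (hB : BECPeriodicReduction.BoundaryTransferWeak) : Assembly :=
  assembly_of_transfer hT (periodicToDirichlet_of_boundaryTransferWeak hB)

/-- `Assembly` modulo torus BEC itself (`BECPeriodicReduction.PeriodicBEC`, verbatim the consequent of
`GDTransfer`) and `PeriodicToDirichlet` (stmt-9483): then `GaussianDominationCan` is not consumed.
[folklore] -/
theorem assembly_of_periodicBEC_of_periodicToDirichlet (hPB : BECPeriodicReduction.PeriodicBEC)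
    (hP : PeriodicToDirichlet) : Assembly :=
  fun _ => hP hPB

/-- `Assembly` modulo torus BEC and the registered stub `RewardPaysTheWall.Unrewarding` of crux
`PeriodicToDirichlet`. [folklore] -/
theorem assembly_of_periodicBEC_of_unrewarding (hPB : BECPeriodicReduction.PeriodicBEC)
    (hU : RewardPaysTheWall.Unrewarding) : Assembly :=
  assembly_of_periodicBEC_of_periodicToDirichlet hPB
    (RewardPaysTheWall.periodicToDirichlet_of_unrewarding hU)

/-- `Assembly` modulo torus BEC and `BoundaryTransferWeak` (stmt-0827). [folklore] -/
theorem assembly_of_periodicBEC_of_boundaryTransferWeak (hPB : BECPeriodicReduction.PeriodicBEC)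
    (hB : BECPeriodicReduction.BoundaryTransferWeak) : Assembly :=
  assembly_of_periodicBEC_of_periodicToDirichlet hPB (periodicToDirichlet_of_boundaryTransferWeak hB)

/-- `Assembly` from the audited conjunct itself: any route closing `BoseEinsteinCondensation` closes
this item. [folklore] -/
theorem assembly_of_bec (h : _root_.BoseEinsteinCondensation) : Assembly :=
  fun _ => h

end Summit.AtomisticToContinuum.BoseEinsteinCondensation.Theorems

/-! ## Reduction to the weakest residual of crux `PeriodicToDirichlet` (session 2026-08-16, seat -3)

Since `Theorems/BECThomsonPrinciplePeriodicToDirichletResidual.lean` the line `reward-pays-the-wall` of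
crux `PeriodicToDirichlet` (stmt-AtomisticToContinuum-9483) is landed up to one reward-free,
single-boundary-condition residual in one Dirichlet cube — "rewarded upper bound ⟹ ground-state BEC",
equivalently (below the density cap) "condensed near-ground states ⟹ ground-state BEC"
(`RewardPaysTheWall.periodicToDirichlet_of_upperBoundToBEC`,
`RewardPaysTheWall.periodicToDirichlet_of_condensedToBEC`, hypotheses spelled out there). Composing with
`assembly_of_transfer` closes `Assembly` modulo `GDTransfer` (stmt-AtomisticToContinuum-9482) and that
residual (in either form), so that `assembly_proof` stays a one-liner against whichever statement
lands. Pure logic; the hypotheses below are those two hypotheses verbatim. -/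

namespace Summit.AtomisticToContinuum.BoseEinsteinCondensation.Theorems

open Filter
open scoped ENNReal
open Literature.MathematicalPhysics.QuantumManyBody.BoseGas
open Summit.AtomisticToContinuum.BoseEinsteinCondensation.Theses.BECThomsonPrinciple

/-- `Assembly` modulo `GDTransfer` (stmt-9482) and the residual "rewarded upper bound ⟹ BEC" of
crux `PeriodicToDirichlet` (the hypothesis of
`RewardPaysTheWall.periodicToDirichlet_of_upperBoundToBEC`, verbatim). [folklore] -/
theorem assembly_of_gdTransfer_of_upperBoundToBEC (hT : GDTransfer)
    (h : ∀ v : ℝ → ℝ≥0∞, IsRepulsiveFiniteRange v → ∃ ρ₄ : ℝ, 0 < ρ₄ ∧ ∀ ρ : ℝ, 0 < ρ → ρ < ρ₄ →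
      ∀ c : ℝ, 0 < c → c ≤ 1 → RewardPaysTheWall.RewardedUpperBound v ρ c →
        HasGroundStateBEC v ρ) :
    Assembly :=
  assembly_of_transfer hT (RewardPaysTheWall.periodicToDirichlet_of_upperBoundToBEC h)

/-- `Assembly` modulo `GDTransfer` (stmt-9482) and the residual "condensed near-ground states ⟹
BEC" of crux `PeriodicToDirichlet` (the hypothesis of
`RewardPaysTheWall.periodicToDirichlet_of_condensedToBEC`, verbatim; it is the registered stub
`stub_condensedToBEC` of that crux's gen-1 skeleton `Lines/reward_pays_the_wall.lean`). [folklore] -/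
theorem assembly_of_gdTransfer_of_condensedToBEC (hT : GDTransfer)
    (h : ∀ v : ℝ → ℝ≥0∞, IsRepulsiveFiniteRange v → ∃ ρ₄ : ℝ, 0 < ρ₄ ∧ ∀ ρ : ℝ, 0 < ρ → ρ < ρ₄ →
      ∀ c : ℝ, 0 < c → c ≤ 1 →
        (∀ θ : ℝ, 0 < θ → ∀ᶠ N : ℕ in atTop, ∃ Ψ : TrialState N (sideLength ρ N),
          energy v Ψ ≤ groundStateEnergy v N (sideLength ρ N) + ENNReal.ofReal (θ * N) ∧
            ENNReal.ofReal ((c - θ) * N) ≤ occupation N (boxConstantMode (sideLength ρ N)) Ψ.ψ) →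
        HasGroundStateBEC v ρ) :
    Assembly :=
  assembly_of_transfer hT (RewardPaysTheWall.periodicToDirichlet_of_condensedToBEC h)

end Summit.AtomisticToContinuum.BoseEinsteinCondensation.Theorems
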